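import Summits.Ventures.YMGap.RobustBall.LocalSourceScreeningS
import Summits.Ventures.YMGap.RobustBall.RowsSN
import HarnessLib

/-!
# Venture YMGap, track ROBUST-BALL (Y2) — tier-2 screening at the weight rate: EVERY `N ≥ 2` (Bakry–Émery pair) and the
# all-`N` cell at 't Hooft `1/64`

HONEST FRAMING. WHAT THIS IS: a venture file (cell `pub-ymgap`, track Y2 ROBUST-BALL, seat rb-p1, theorems only): the every-`N`
column of `LocalSourceScreeningS.lean` (tier 2, RATE = WEIGHT):
* `suN_localScreeningS_bakryEmery` — every `N ≥ 2`, every `d ≥ 1`, HYPOTHESIS-FREE (Bakry–Émery one-link pair,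
  `b = 2(d−1)|β| < 1/2`): `ρ := 6(d−1)|β| e^{a} e^{t}/(1/2 − b) + e^{a/2} Λ/√(N(1/2 − b)) < 1 ⇒` for every member `W` of
  `MemBallZdS a Λ t`, every continuous link-summable source `V` (ANY strength) whose loads (`≤ B`) vanish off the finite link set
  `S`, every DLR `μ` of `W`, EVERY DLR `ν` of `W + V`, every Lipschitz cylinder `F` (`Λ_F`, `K_F`):
  `|∫ F dμ − ∫ F dν| ≤ (√N/2)·min(B,4)/(1 − ρ) · e^{−t·d(Λ_F,S)} · #Λ_F · K_F`;
* `suN_localScreeningS_1_64` — the all-`N` cell of record (`UniformMassGapS.suN_uniformRowS_1_64`): 't Hooft `1/64`, ball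
  `(a, Λ) = (1/20, 1/10)` at weight `log(6/5)`: `ρ ≤ 99/100`, so every source is screened at rate `log(6/5)` with constant
  `50√N · min(B,4) · #Λ_F · K_F`, for EVERY `N ≥ 2`.
WHAT THIS IS NOT: one-sided Dobrushin-comparison bounds; the constant grows like `√N` (the KR diameter of `SU(N)`); lattice
strong coupling only, nothing about the continuum limit or a Clay-sense mass gap.
-/

noncomputable section

open MeasureTheory Function Finset ProbabilityTheory Real
open scoped NNReal
open Literature.Probability.LatticeModels
open Literature.Probability.LatticeModels.DobrushinMetric
open Literature.MathematicalPhysics.QuantumLattice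
open Literature.MathematicalPhysics.QuantumFieldTheory hiding ZdEdge
open Summit.QuantumFields.BalabanUV.InfraRed.StrongCouplingPoincareDoorSUN (oneLinkPoincareSUN_bakryEmery)
open Summit.QuantumFields.BalabanUV.InfraRed.StrongCouplingVarianceDoorSUN (oneLinkVarianceBound_bakryEmery)

namespace Summit.Ventures.YMGap.RobustBall

variable {d N : ℕ}

/-- **EVERY `N ≥ 2`, EVERY `d ≥ 1`, HYPOTHESIS-FREE — tier-2 screening at the weight rate from the Bakry–Émery pair.**
`b = 2(d−1)|β| < 1/2`, `ρ := 6(d−1)|β| e^{a} e^{t}/(1/2 − b) + e^{a/2} Λ/√(N(1/2 − b)) < 1`, `t ≥ 0`: for every member `W`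
of `MemBallZdS a Λ t`, every continuous link-summable source `V` with loads `≤ B` off-`S`-vanishing, every DLR pair, every
Lipschitz cylinder: `|∫ F dμ − ∫ F dν| ≤ (√N/2)·min(B,4)/(1 − ρ) · e^{−t·d(Λ_F,S)} · #Λ_F · K_F`. -/
theorem suN_localScreeningS_bakryEmery (hd : 1 ≤ d) (hN : 2 ≤ N) {β a Λ t : ℝ} (ht : 0 ≤ t)
    (hb : |β| * (2 * ((d : ℝ) - 1)) < 1 / 2)
    (hρ : 6 * ((d : ℝ) - 1) * |β| * (exp a * exp t) / (1 / 2 - |β| * (2 * ((d : ℝ) - 1))) +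
      exp (a / 2) * Λ / Real.sqrt ((N : ℝ) * (1 / 2 - |β| * (2 * ((d : ℝ) - 1)))) < 1)
    {W V : Potential (ZdEdge d) (Matrix.specialUnitaryGroup (Fin N) ℂ)} (hmem : MemBallZdS a Λ t W)
    {BV : Finset (ZdEdge d) → ℝ} (hV : IsLinkSummable V BV) (hVc : ∀ X, Continuous (V X))
    (hVdep : ∀ X, DependsOn (V X) (↑X : Set (ZdEdge d)))
    {oscV : Finset (ZdEdge d) → ZdEdge d → ℝ} (hoscV : ∀ X, Dobrushin.IsOscBound (V X) (oscV X))
    (hoscVs : ∀ e, Summable fun X : Finset (ZdEdge d) => (if e ∈ X then oscV X e else 0))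
    {bV : ZdEdge d → ℝ} (hbV : ∀ e, ∑' X : Finset (ZdEdge d), (if e ∈ X then oscV X e else 0) ≤ bV e)
    {B : ℝ} (hB : ∀ e, bV e ≤ B) {S : Finset (ZdEdge d)} (hS : ∀ e, e ∉ S → bV e ≤ 0)
    {μ ν : Measure (LGConfig d (Matrix.specialUnitaryGroup (Fin N) ℂ))}
    (hμ : μ ∈ perturbedGibbsMeasuresS (d := d) (fundamentalRep (Fin N)) (N * β) W)
    (hν : ν ∈ perturbedGibbsMeasuresS (d := d) (fundamentalRep (Fin N)) (N * β) (W + V))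
    {F : LGConfig d (Matrix.specialUnitaryGroup (Fin N) ℂ) → ℝ} {ΛF : Finset (ZdEdge d)} {KF : ℝ≥0}
    (hF : IsLipschitzCylinder (fundamentalRep (Fin N)) F ΛF KF) :
    |(∫ σ, F σ ∂μ) - ∫ σ, F σ ∂ν| ≤
      Real.sqrt N / 2 * min B 4 / (1 - (6 * ((d : ℝ) - 1) * |β| * (exp a * exp t) / (1 / 2 - |β| * (2 * ((d : ℝ) - 1))) +
        exp (a / 2) * Λ / Real.sqrt ((N : ℝ) * (1 / 2 - |β| * (2 * ((d : ℝ) - 1)))))) *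
        exp (-t * setDistEdges ΛF S) * (ΛF.card * KF) := by
  classical
  haveI : SecondCountableTopology (Matrix (Fin N) (Fin N) ℂ) :=
    inferInstanceAs (SecondCountableTopology (Fin N → Fin N → ℂ))
  haveI : SecondCountableTopology (Matrix.specialUnitaryGroup (Fin N) ℂ) :=
    Topology.IsEmbedding.subtypeVal.secondCountableTopology
  set b : ℝ := |β| * (2 * ((d : ℝ) - 1)) with hbdef
  have hNpos : (0 : ℝ) < N := by exact_mod_cast (show 0 < N by omega)
  have hgap : 0 < 1 / 2 - b := by linarith
  have hP := oneLinkPoincareSUN_bakryEmery hN hb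
  have hVv := oneLinkVarianceBound_bakryEmery hN hb
  have hc : (0 : ℝ) ≤ 1 / ((N : ℝ) * (1 / 2 - b)) := by positivity
  have hv : (0 : ℝ) ≤ (N : ℝ) / (1 / 2 - b) := by positivity
  obtain ⟨BW, h⟩ := hmem.summable
  obtain ⟨osc, lip, ℓ, hosc, hlip, hoscs, hosca, hlips, hℓ, hℓs, hℓt⟩ := hmem.loads
  have hsq1 : Real.sqrt (1 / ((N : ℝ) * (1 / 2 - b)) * ((N : ℝ) / (1 / 2 - b))) = 1 / (1 / 2 - b) := by
    rw [show 1 / ((N : ℝ) * (1 / 2 - b)) * ((N : ℝ) / (1 / 2 - b)) = (1 / (1 / 2 - b)) ^ 2 by field_simp,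
      Real.sqrt_sq (by positivity)]
  have hsq2 : Real.sqrt (1 / ((N : ℝ) * (1 / 2 - b))) = 1 / Real.sqrt ((N : ℝ) * (1 / 2 - b)) := by
    rw [Real.sqrt_div' _ (mul_nonneg hNpos.le hgap.le), Real.sqrt_one]
  have hρeq : 6 * ((d : ℝ) - 1) * |β| * (exp a * exp t * Real.sqrt (1 / ((N : ℝ) * (1 / 2 - b)) * ((N : ℝ) / (1 / 2 - b)))) +
      exp (a / 2) * Real.sqrt (1 / ((N : ℝ) * (1 / 2 - b))) * Λ =
      6 * ((d : ℝ) - 1) * |β| * (exp a * exp t) / (1 / 2 - b) + exp (a / 2) * Λ / Real.sqrt ((N : ℝ) * (1 / 2 - b)) := by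
    rw [hsq1, hsq2]; ring
  have hρ' : 6 * ((d : ℝ) - 1) * |β| * (exp a * exp t * Real.sqrt (1 / ((N : ℝ) * (1 / 2 - b)) * ((N : ℝ) / (1 / 2 - b)))) +
      exp (a / 2) * Real.sqrt (1 / ((N : ℝ) * (1 / 2 - b))) * Λ < 1 := by rw [hρeq]; exact hρ
  have hA : ∀ a' b' : Matrix.specialUnitaryGroup (Fin N) ℂ,
      dist (suEntries a') (suEntries b') ≤ 1 * suFrobDist a' b' :=
    fun a' b' => by rw [one_mul]; exact dist_suEntries_le_suFrobDist a' b'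
  have key := abs_integral_sub_integral_le_of_source_S hd (by omega) hc hv le_rfl (fun B hB => hP B hB)
    (fun B hB => hVv B hB) h hmem.continuous hmem.dependsOn hosc hoscs hosca hlip hlips hℓ ht hℓs hℓt hρ' hV hVc hVdep hoscV
    hoscVs hbV hB hS hμ hν hF.measurable hF.dependsOn hF.abs_le (hF.isLipBound zero_le_one hA)
  rw [hρeq] at key
  refine key.trans ?_
  set ρ : ℝ := 6 * ((d : ℝ) - 1) * |β| * (exp a * exp t) / (1 / 2 - b) + exp (a / 2) * Λ / Real.sqrt ((N : ℝ) * (1 / 2 - b))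
    with hρdef
  have h1ρ : 0 < 1 - ρ := sub_pos.2 hρ
  have hd0 : 0 < d := hd
  have hbV0 : ∀ e, 0 ≤ bV e := fun e =>
    le_trans (tsum_nonneg fun X => by split_ifs; exacts [(hoscV X).nonneg e, le_rfl]) (hbV e)
  have hBmin : 0 ≤ min B 4 := le_min ((hbV0 (0, ⟨0, hd0⟩)).trans (hB _)) (by norm_num)
  have hK0 : 0 ≤ Real.sqrt N / 2 * min B 4 / (1 - ρ) := by positivity
  have hmono : ∑ y ∈ ΛF, exp (-t * linkSetDist S y) * (if y ∈ ΛF then (1 : ℝ) * (KF : ℝ) else 0) ≤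
      exp (-t * setDistEdges ΛF S) * (ΛF.card * KF) := by
    calc ∑ y ∈ ΛF, exp (-t * linkSetDist S y) * (if y ∈ ΛF then (1 : ℝ) * (KF : ℝ) else 0)
        ≤ ∑ y ∈ ΛF, exp (-t * setDistEdges ΛF S) * KF := Finset.sum_le_sum fun y hy => by
          rw [if_pos hy, one_mul]
          refine mul_le_mul_of_nonneg_right (exp_le_exp.2 ?_) KF.2
          have := setDistEdges_le_linkSetDist (Λ₂ := S) hy
          nlinarith
      _ = exp (-t * setDistEdges ΛF S) * (ΛF.card * KF) := by rw [Finset.sum_const, nsmul_eq_mul]; ring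
  calc Real.sqrt N / 2 * min B 4 / (1 - ρ) *
        ∑ y ∈ ΛF, exp (-t * linkSetDist S y) * (if y ∈ ΛF then (1 : ℝ) * (KF : ℝ) else 0)
      ≤ Real.sqrt N / 2 * min B 4 / (1 - ρ) * (exp (-t * setDistEdges ΛF S) * (ΛF.card * KF)) :=
        mul_le_mul_of_nonneg_left hmono hK0
    _ = _ := by ring

/-- **ALL `N ≥ 2` AT ONCE, 't Hooft `1/64`, tier-2 ball `(1/20, 1/10)` at weight `log(6/5)`** (the cell of
`UniformMassGapS.suN_uniformRowS_1_64`): the Bakry–Émery row sum is `≤ 99/100` for every `N ≥ 2`, so every continuous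
link-summable source on `S` is screened at rate `log(6/5)` with constant `50√N · min(B,4)`:
`|∫ F dμ − ∫ F dν| ≤ 50√N · min(B,4) · e^{−log(6/5)·d(Λ_F,S)} · #Λ_F · K_F`. -/
theorem suN_localScreeningS_1_64 {N : ℕ} (hN : 2 ≤ N)
    {W V : Potential (ZdEdge 4) (Matrix.specialUnitaryGroup (Fin N) ℂ)}
    (hmem : MemBallZdS (1 / 20) (1 / 10) (Real.log (6 / 5)) W)
    {BV : Finset (ZdEdge 4) → ℝ} (hV : IsLinkSummable V BV) (hVc : ∀ X, Continuous (V X))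
    (hVdep : ∀ X, DependsOn (V X) (↑X : Set (ZdEdge 4)))
    {oscV : Finset (ZdEdge 4) → ZdEdge 4 → ℝ} (hoscV : ∀ X, Dobrushin.IsOscBound (V X) (oscV X))
    (hoscVs : ∀ e, Summable fun X : Finset (ZdEdge 4) => (if e ∈ X then oscV X e else 0))
    {bV : ZdEdge 4 → ℝ} (hbV : ∀ e, ∑' X : Finset (ZdEdge 4), (if e ∈ X then oscV X e else 0) ≤ bV e)
    {B : ℝ} (hB : ∀ e, bV e ≤ B) {S : Finset (ZdEdge 4)} (hS : ∀ e, e ∉ S → bV e ≤ 0)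
    {μ ν : Measure (LGConfig 4 (Matrix.specialUnitaryGroup (Fin N) ℂ))}
    (hμ : μ ∈ perturbedGibbsMeasuresS (d := 4) (fundamentalRep (Fin N)) (N * (1 / 64)) W)
    (hν : ν ∈ perturbedGibbsMeasuresS (d := 4) (fundamentalRep (Fin N)) (N * (1 / 64)) (W + V))
    {F : LGConfig 4 (Matrix.specialUnitaryGroup (Fin N) ℂ) → ℝ} {ΛF : Finset (ZdEdge 4)} {KF : ℝ≥0}
    (hF : IsLipschitzCylinder (fundamentalRep (Fin N)) F ΛF KF) :
    |(∫ σ, F σ ∂μ) - ∫ σ, F σ ∂ν| ≤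
      50 * Real.sqrt N * min B 4 * exp (-Real.log (6 / 5) * setDistEdges ΛF S) * (ΛF.card * KF) := by
  have hq : exp (Real.log (6 / 5)) = 6 / 5 := Real.exp_log (by norm_num)
  have hN2 : (2 : ℝ) ≤ N := by exact_mod_cast hN
  have hb : |(1 / 64 : ℝ)| * (2 * (((4 : ℕ) : ℝ) - 1)) < 1 / 2 := by
    rw [abs_of_pos (by norm_num : (0 : ℝ) < 1 / 64)]; norm_num
  have hgap : (1 / 2 - |(1 / 64 : ℝ)| * (2 * (((4 : ℕ) : ℝ) - 1))) = 13 / 32 := by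
    rw [abs_of_pos (by norm_num : (0 : ℝ) < 1 / 64)]; norm_num
  -- the row sum is at most `99/100`
  have hρle : 6 * (((4 : ℕ) : ℝ) - 1) * |(1 / 64 : ℝ)| * (exp (1 / 20) * exp (Real.log (6 / 5))) /
      (1 / 2 - |(1 / 64 : ℝ)| * (2 * (((4 : ℕ) : ℝ) - 1))) +
      exp (1 / 20 / 2) * (1 / 10) / Real.sqrt ((N : ℝ) * (1 / 2 - |(1 / 64 : ℝ)| * (2 * (((4 : ℕ) : ℝ) - 1)))) ≤
      99 / 100 := by
    rw [hgap, hq, abs_of_pos (by norm_num : (0 : ℝ) < 1 / 64)]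
    have h1 := exp_le_taylor4 (x := 1 / 20) (by norm_num) (by norm_num)
    have h2 := exp_le_taylor4 (x := 1 / 20 / 2) (by norm_num) (by norm_num)
    have hs : (901 / 1000 : ℝ) ≤ Real.sqrt ((N : ℝ) * (13 / 32)) := by
      refine sqrt_thirteen_sixteenths_ge.trans (Real.sqrt_le_sqrt ?_)
      nlinarith
    have hs0 : (0 : ℝ) < Real.sqrt ((N : ℝ) * (13 / 32)) := by linarith
    have hsecond : exp (1 / 20 / 2) * (1 / 10) / Real.sqrt ((N : ℝ) * (13 / 32)) ≤
        (1 + 1 / 20 / 2 + (1 / 20 / 2) ^ 2 / 2 + (1 / 20 / 2) ^ 3 / 6 + 5 / 96 * (1 / 20 / 2) ^ 4) * (1 / 10) /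
          (901 / 1000) := by
      rw [div_le_div_iff₀ hs0 (by norm_num)]
      have he0 : 0 < exp (1 / 20 / 2) := exp_pos _
      nlinarith [hs, h2, he0]
    have hfirst : 6 * (((4 : ℕ) : ℝ) - 1) * (1 / 64) * (exp (1 / 20) * (6 / 5)) / (13 / 32) ≤
        6 * 3 * (1 / 64) * ((1 + 1 / 20 + (1 / 20) ^ 2 / 2 + (1 / 20) ^ 3 / 6 + 5 / 96 * (1 / 20) ^ 4) * (6 / 5)) /
          (13 / 32) := by
      push_cast
      gcongr
      norm_num
    calc 6 * (((4 : ℕ) : ℝ) - 1) * (1 / 64) * (exp (1 / 20) * (6 / 5)) / (13 / 32) +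
          exp (1 / 20 / 2) * (1 / 10) / Real.sqrt ((N : ℝ) * (13 / 32))
        ≤ 6 * 3 * (1 / 64) * ((1 + 1 / 20 + (1 / 20) ^ 2 / 2 + (1 / 20) ^ 3 / 6 + 5 / 96 * (1 / 20) ^ 4) * (6 / 5)) /
            (13 / 32) +
          (1 + 1 / 20 / 2 + (1 / 20 / 2) ^ 2 / 2 + (1 / 20 / 2) ^ 3 / 6 + 5 / 96 * (1 / 20 / 2) ^ 4) * (1 / 10) /
            (901 / 1000) := add_le_add hfirst hsecond
      _ ≤ 99 / 100 := by norm_num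
  have hρ : 6 * (((4 : ℕ) : ℝ) - 1) * |(1 / 64 : ℝ)| * (exp (1 / 20) * exp (Real.log (6 / 5))) /
      (1 / 2 - |(1 / 64 : ℝ)| * (2 * (((4 : ℕ) : ℝ) - 1))) +
      exp (1 / 20 / 2) * (1 / 10) / Real.sqrt ((N : ℝ) * (1 / 2 - |(1 / 64 : ℝ)| * (2 * (((4 : ℕ) : ℝ) - 1)))) < 1 :=
    hρle.trans_lt (by norm_num)
  have key := suN_localScreeningS_bakryEmery (d := 4) (by norm_num) hN (Real.log_nonneg (by norm_num)) hb hρ hmem hV hVc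
    hVdep hoscV hoscVs hbV hB hS hμ hν hF
  refine key.trans ?_
  set ρ : ℝ := 6 * (((4 : ℕ) : ℝ) - 1) * |(1 / 64 : ℝ)| * (exp (1 / 20) * exp (Real.log (6 / 5))) /
      (1 / 2 - |(1 / 64 : ℝ)| * (2 * (((4 : ℕ) : ℝ) - 1))) +
      exp (1 / 20 / 2) * (1 / 10) / Real.sqrt ((N : ℝ) * (1 / 2 - |(1 / 64 : ℝ)| * (2 * (((4 : ℕ) : ℝ) - 1)))) with hρdef
  have h1ρ : 1 / 100 ≤ 1 - ρ := by linarith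
  have hbV0 : ∀ e, 0 ≤ bV e := fun e =>
    le_trans (tsum_nonneg fun X => by split_ifs; exacts [(hoscV X).nonneg e, le_rfl]) (hbV e)
  have hBmin : 0 ≤ min B 4 := le_min ((hbV0 ((0 : Fin 4 → ℤ), (0 : Fin 4))).trans (hB _)) (by norm_num)
  have hinv : 1 / (1 - ρ) ≤ 100 := by
    rw [div_le_iff₀ (by linarith)]; linarith
  have hX : 0 ≤ Real.sqrt N / 2 * min B 4 * (exp (-Real.log (6 / 5) * setDistEdges ΛF S) * (ΛF.card * KF)) := by
    positivity
  calc Real.sqrt N / 2 * min B 4 / (1 - ρ) * exp (-Real.log (6 / 5) * setDistEdges ΛF S) * (ΛF.card * KF)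
      = 1 / (1 - ρ) * (Real.sqrt N / 2 * min B 4 * (exp (-Real.log (6 / 5) * setDistEdges ΛF S) * (ΛF.card * KF))) := by
        ring
    _ ≤ 100 * (Real.sqrt N / 2 * min B 4 * (exp (-Real.log (6 / 5) * setDistEdges ΛF S) * (ΛF.card * KF))) :=
        mul_le_mul_of_nonneg_right hinv hX
    _ = 50 * Real.sqrt N * min B 4 * exp (-Real.log (6 / 5) * setDistEdges ΛF S) * (ΛF.card * KF) := by ring

end Summit.Ventures.YMGap.RobustBall

end
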